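import Literature.AlgebraicGeometry.Motives.JacobianGaloisCoverNorm
import Literature.AlgebraicGeometry.Motives.AbelianVarietyWeilDivisor
import Literature.AlgebraicGeometry.Motives.CartierDivisorClassPullback
import Literature.AlgebraicGeometry.Motives.CartierDivisorCurveDegree
import HarnessLib

/-!
# Lange's (4.9) in divisor currency, `D^{Θ_X}_{p^* y} ∼ Nm_p^* D^{Θ_Y}_y`, from the leaves of road G4 (Cor. 4.4.5 on both curves,
# naturality of the Abel–Jacobi sum, Mumford §8 Thm. 1) — the top of the DAG, kernel-checked before the leaves land

Layer `Literature/AlgebraicGeometry/Motives`, namespace `Literature.AlgebraicGeometry.Motives.Jacobian`.  KERNEL ONLY: theorems; no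
definition, no named fact, no instance, no `sorry`.  GLUE I of road G4 (cell `hodgecm-mathlib`, director ruling s225; letters
`A-provers/A-p04/g17/G4.sockets.v2.A-p04g17.lean` §4) with the four leaves taken as EXPLICIT HYPOTHESES on an abstract
«Abel–Jacobi sum» `aj : CartierDivisor C → J(ℂ)` (the carrier `Jacobian.ajSum` of letter §0 is one instance; nothing here depends on
its definition):

given Jacobians `𝒥X`, `𝒥Y` of integral curves `X`, `Y`, a dominant `p : X → Y`, homomorphisms `Nm : J_X → J_Y` (dominant) and
`t : J_Y → J_X` with Lange's square `α_c ≫ Nm = p ≫ α_{c′}` (`c′ = p(c)`; for `Nm = Nm_p` this is ★ `abelJacobi_comp_pushforward`),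
divisors `Θ_X`, `Θ_Y`, and
* (COR-X) `aj_X(α_c^♮ D^{Θ_X}_x) = x⁻¹` for all `x ∈ J_X(ℂ)` and (COR-Y) `aj_Y(α_{c′}^♮ D^{Θ_Y}_y) = y⁻¹` for all `y ∈ J_Y(ℂ)`
  ([Lange2023AbelianVarietiesComplex] Cor. 4.4.5 «`(α_c^*)⁻¹ = −φ_Θ`» = [Milne1986JacobianVarieties] §6 Lem. 6.9, points form; letter (g4-3)),
* (NAT) `aj_X(p^* E) = t(aj_Y(E))` for degree-`0` divisors `E` on `Y` (letter §2; for a Galois cover with pinned `t`),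
* (DEG) `deg_Y(α_{c′}^♮ D^{Θ_Y}_y) = 0` (translation classes have degree `0` on curves),
* (LIN) `aj_X` is constant on linear equivalence classes (Abel, letter (g4-1e)),
* (PIC) `Nm^* D^{Θ_Y}_y ∼ D^{Θ_X}_x` for SOME `x` (letter §1, Mumford §8 Thm. 1 over `ℂ`),
then **`D^{Θ_X}_{t y} ∼ Nm^* D^{Θ_Y}_y`** for every `y ∈ J_Y(ℂ)` (`α^♮` = ★ `CartierDivisor.classPullback`, `D^Θ_x` = ★ `AbelianVariety.weilDiv`).
Proof: `aj_X(α_c^♮ Nm^* D_y)` equals `x⁻¹` by (PIC)+(LIN)+(COR-X), and equals `t(y)⁻¹` by functoriality of `α^♮`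
(★ `classPullback_comp_linEquiv`, ★ `classPullback_linEquiv_pullback`), Lange's square, (NAT)+(DEG) and (COR-Y); so `x = t y`.

COUNT-NEUTRAL (conditional on the leaves).  HC_CM is proved only modulo the 7 printed citations until rung 0 closes; this file moves no
book by itself.

## References
* [Lange2023AbelianVarietiesComplex] H. Lange, *Abelian Varieties over the Complex Numbers* (2023), §4.4.2 Cor. 4.4.5, §4.5.2 eq. (4.9).
* [Milne1986JacobianVarieties] J. S. Milne, *Jacobian Varieties*, in Cornell–Silverman (1986), §6 Lemma 6.9, Prop. 6.4.
* [MumfordAV1970] D. Mumford, *Abelian Varieties* (1970), §8 Thm. 1 (p. 77).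
-/

set_option autoImplicit false

noncomputable section

open CategoryTheory AlgebraicGeometry

namespace Literature.AlgebraicGeometry.Motives

namespace Jacobian

variable {X Y : SchemeOver ℂ} [IsIntegral X.left] [IsIntegral Y.left] [IsProper Y.hom]

/-- **GLUE I of road G4 from its leaves**: `D^{Θ_X}_{t y} ∼ Nm^* D^{Θ_Y}_y` (Lange (4.9) «`N̂_f φ_{Θ′} = φ_Θ f^*`» in divisor currency), for
every `y ∈ J_Y(ℂ)`, from (COR-X), (COR-Y), (NAT), (DEG), (LIN), (PIC) — see the module docstring.
[cite: Lange2023AbelianVarietiesComplex, §4.5.2 eq. (4.9) and §4.4.2 Cor. 4.4.5] [cite: Milne1986JacobianVarieties, §6 Lemma 6.9 and Prop. 6.4]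
[cite: MumfordAV1970, §8 Thm. 1 (p. 77)] -/
theorem weilDiv_map_linEquiv_pullback_weilDiv_of_leaves (𝒥X : Jacobian X) (𝒥Y : Jacobian Y)
    (p : X ⟶ Y) [IsDominant p.left] (Nm : 𝒥X.J ⟶ 𝒥Y.J) [IsDominant (AbelianVariety.Hom.toSchemeHom Nm)] (t : 𝒥Y.J ⟶ 𝒥X.J)
    (c : AlgPoints X ℂ) (hsq : 𝒥X.abelJacobi c ≫ Nm.hom.hom.hom = p ≫ 𝒥Y.abelJacobi (AlgPoints.map p c))
    (ΘX : CartierDivisor 𝒥X.J.X.left) (ΘY : CartierDivisor 𝒥Y.J.X.left)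
    (ajX : CartierDivisor X.left → 𝒥X.J.Points ℂ) (ajY : CartierDivisor Y.left → 𝒥Y.J.Points ℂ)
    (hcorX : ∀ x : 𝒥X.J.Points ℂ, ajX ((𝒥X.J.weilDiv ΘX x).classPullback (𝒥X.abelJacobi c).left) = x⁻¹)
    (hcorY : ∀ y : 𝒥Y.J.Points ℂ,
      ajY ((𝒥Y.J.weilDiv ΘY y).classPullback (𝒥Y.abelJacobi (AlgPoints.map p c)).left) = y⁻¹)
    (hnat : ∀ E : CartierDivisor Y.left, CartierDivisor.degree Y E = 0 →
      ajX (E.pullback p.left) = AlgPoints.map t.hom.hom.hom (ajY E))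
    (hdeg : ∀ y : 𝒥Y.J.Points ℂ,
      CartierDivisor.degree Y ((𝒥Y.J.weilDiv ΘY y).classPullback (𝒥Y.abelJacobi (AlgPoints.map p c)).left) = 0)
    (hlin : ∀ D E : CartierDivisor X.left, D.LinEquiv E → ajX D = ajX E)
    (hpic : ∀ y : 𝒥Y.J.Points ℂ, ∃ x : 𝒥X.J.Points ℂ,
      ((𝒥Y.J.weilDiv ΘY y).pullback (AbelianVariety.Hom.toSchemeHom Nm)).LinEquiv (𝒥X.J.weilDiv ΘX x))
    (y : 𝒥Y.J.Points ℂ) :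
    (𝒥X.J.weilDiv ΘX (AlgPoints.map t.hom.hom.hom y)).LinEquiv
      ((𝒥Y.J.weilDiv ΘY y).pullback (AbelianVariety.Hom.toSchemeHom Nm)) := by
  obtain ⟨x, hx⟩ := hpic y
  -- (1) `aj_X(α_c^♮ Nm^* D_y) = x⁻¹`
  have h1 : ajX (((𝒥Y.J.weilDiv ΘY y).pullback (AbelianVariety.Hom.toSchemeHom Nm)).classPullback (𝒥X.abelJacobi c).left) =
      x⁻¹ := by
    rw [hlin _ _ (hx.classPullback (𝒥X.abelJacobi c).left)]
    exact hcorX x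
  -- (2) `α_c^♮ Nm^* D_y ∼ p^* (α_{c′}^♮ D_y)` (functoriality of the class pull-back and Lange's square)
  have hsq' : (𝒥X.abelJacobi c).left ≫ AbelianVariety.Hom.toSchemeHom Nm =
      p.left ≫ (𝒥Y.abelJacobi (AlgPoints.map p c)).left :=
    congrArg CommaMorphism.left hsq
  have h2 : (((𝒥Y.J.weilDiv ΘY y).pullback (AbelianVariety.Hom.toSchemeHom Nm)).classPullback (𝒥X.abelJacobi c).left).LinEquiv
      (((𝒥Y.J.weilDiv ΘY y).classPullback (𝒥Y.abelJacobi (AlgPoints.map p c)).left).pullback p.left) := by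
    -- `Nm^*D_y ∼ Nm^♮ D_y`, so `α_c^♮ Nm^* D_y ∼ α_c^♮ Nm^♮ D_y ∼ (α_c ≫ Nm)^♮ D_y = (p ≫ α_{c′})^♮ D_y ∼ p^♮ α_{c′}^♮ D_y ∼ p^* α_{c′}^♮ D_y`
    have e1 := ((𝒥Y.J.weilDiv ΘY y).classPullback_linEquiv_pullback (AbelianVariety.Hom.toSchemeHom Nm)).symm.classPullback
      (𝒥X.abelJacobi c).left
    have e2 := (CartierDivisor.classPullback_comp_linEquiv (AbelianVariety.Hom.toSchemeHom Nm) (𝒥X.abelJacobi c).left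
      (𝒥Y.J.weilDiv ΘY y)).symm
    have e3 : ((𝒥Y.J.weilDiv ΘY y).classPullback ((𝒥X.abelJacobi c).left ≫ AbelianVariety.Hom.toSchemeHom Nm)).LinEquiv
        ((𝒥Y.J.weilDiv ΘY y).classPullback (p.left ≫ (𝒥Y.abelJacobi (AlgPoints.map p c)).left)) := by
      rw [hsq']
      exact CartierDivisor.LinEquiv.refl _
    have e4 := CartierDivisor.classPullback_comp_linEquiv (𝒥Y.abelJacobi (AlgPoints.map p c)).left p.left (𝒥Y.J.weilDiv ΘY y)
    have e5 := ((𝒥Y.J.weilDiv ΘY y).classPullback (𝒥Y.abelJacobi (AlgPoints.map p c)).left).classPullback_linEquiv_pullback p.left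
    exact (((e1.trans e2).trans e3).trans e4).trans e5
  -- (3) hence `aj_X(α_c^♮ Nm^* D_y) = t(aj_Y(α_{c′}^♮ D_y)) = t(y⁻¹) = (t y)⁻¹`
  have h3 : ajX (((𝒥Y.J.weilDiv ΘY y).pullback (AbelianVariety.Hom.toSchemeHom Nm)).classPullback (𝒥X.abelJacobi c).left) =
      (AlgPoints.map t.hom.hom.hom y)⁻¹ := by
    rw [hlin _ _ h2, hnat _ (hdeg y), hcorY y, AlgPoints.map_apply, AlgPoints.map_apply]
    exact GrpObj.inv_comp _ _
  -- (4) `x = t y`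
  have hxy : x = AlgPoints.map t.hom.hom.hom y := inv_injective (h1.symm.trans h3)
  rw [← hxy]
  exact hx.symm

end Jacobian

end Literature.AlgebraicGeometry.Motives

end
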